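import Literature.Analysis.FluidPDE.TypeIAncientMild
import Literature.Analysis.FluidPDE.TypeIAncientMildClassical
import Literature.Analysis.FluidPDE.ChaeWolfRemovingDSSProofs
import Literature.Analysis.FluidPDE.PineauVicolRDSSLeray
import Summits.NavierStokesRegularity.NavierStokesRegularity.Theorems.PoloidalWindowDoorPoloidalWindowRigidityStrata
import HarnessLib

/-!
# Route `LerayQuarterDissipation`, crux `FiniteDissipationLiouville` (stmt-NavierStokesRegularity-22144),
  line `birth` — the two leaves of `stub_dssExclusion` that are theorems in print, in the KNSS gauge

`--supports stmt-NavierStokesRegularity-22144`. The registered stub `stub_dssExclusion` (backward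
`λ`-DSS exclusion in the finite-dissipation stratum, every `λ > 1`) is — on DSS fields — letter for
letter a Liouville statement (`Theorems.FiniteDissipationLiouville.Negative.dssExclusion_iff_dssLiouville`,
landed by the crux's disprover) and OPEN for large `λ` (Bradshaw–Tsai 2017 Open Problem 5.1; Chae–Wolf 2017 Thm 1.3
and Pineau–Vicol 2026 Thm 1.6 cover only `λ` close to `1`). This file records, positively and in
the exact class of the crux (Type-I ancient mild fields in the KNSS gauge), the two leaves that ARE
theorems, so that the census of the stub names precisely what remains:

* `eq_zero_of_isSelfSimilar` — **the self-similar leaf** (`λ`-DSS for every `λ > 0`): a Type-I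
  ancient mild field which is self-similar (`IsSelfSimilar`, the tree's `nsRescale c w = w` for all
  `c > 0`) vanishes on `t < 0`. This is the tree's `eq_zero_of_scaleInvariant` (route
  PoloidalWindowDoor, strata file: KNSS pressure + Leray's reduction + Tsai 1998 Thm 1 with
  `q = ∞`, `IsLerayProfile.exists_eq_const_of_bounded`, + the gauge kills constants) restated over
  `IsTypeIAncientMild`; no dissipation law is needed.
* `exists_dss_threshold_of_envelope` — **the near-identity leaf under the space-time envelope**:
  for every `C₀ > 0` there is `c₁ > 1` such that every Type-I ancient mild field with the envelope
  `‖w(t,x)‖ ≤ C₀/(‖x‖ + √(−t))` (`HasTypeIDecay C₀ w`) which is `c`-DSS for some `1 < c < c₁`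
  vanishes on `t < 0`: the KNSS pressure on a window (`IsTypeIAncientMild.exists_isClassicalNSSolutionOn_Ioo`,
  Fabes–Jones–Rivière), its DSS continuation to `(−∞,0)`
  (`exists_isClassicalNSSolutionOn_Iio_of_isRotatedDSS`, Pineau–Vicol's bookkeeping), and
  Chae–Wolf 2017 Thm 1.3 PROVED in the tree (`chaeWolf2017_removing_dss_holds`).
* `dssExclusion_of_isSelfSimilar`, `dssExclusion_nearOne_of_envelope` — the same two leaves in the
  regularity form of the stub (bounded at the apex).

WHAT IS NOT HERE (the open remainder of the stub, honestly): (i) `c ≥ c₁(C₀)`; (ii) the envelope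
hypothesis itself — for members of the stratum it should follow from Chae–Wolf 2017 Thm 1.1 with
`p = 6` (tree `chaeWolf2017_dss_typeI_decay_of_lt_nine`) once the slices are shown to lie in
`L⁶` (Sobolev modulo constants, the constant being killed by the gauge) and to depend continuously
on time in `L⁶`; neither step is formalised here. Nothing in this file bears on Navier–Stokes
regularity; no summit is proved.
-/

noncomputable section

open Set MeasureTheory Filter Topology Function Metric
open Literature.Analysis Literature.Analysis.FluidPDE
open scoped ENNReal NNReal

namespace Summit.NavierStokesRegularity.NavierStokesRegularity.Theorems.FiniteDissipationLiouville.Birth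

-- the problem-side namespace duplicates `NavierStokesRegularity` by design (summit = problem)
set_option linter.dupNamespace false

open Summit.NavierStokesRegularity.NavierStokesRegularity.Theorems.PoloidalWindowDoorPoloidalWindowRigidityStrata
  (eq_zero_of_scaleInvariant)
open Literature.Analysis.FluidPDE.PineauVicol2026 (exists_isClassicalNSSolutionOn_Iio_of_isRotatedDSS)

/-- A field vanishing on the past is bounded (by `0`) on the unit backward cylinder, hence not
singular at the apex (the route's singular clause at `r = 1`, `M = 0`). -/
theorem not_singularAtApex_of_eq_zero
    {u : ℝ → EuclideanSpace ℝ (Fin 3) → EuclideanSpace ℝ (Fin 3)} (hu : ∀ t < 0, ∀ x, u t x = 0) :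
    ¬ (∀ r > 0, ∀ M : ℝ, ∃ t ∈ Set.Ioo (-(r ^ 2)) (0 : ℝ),
        ∃ x ∈ Metric.ball (0 : EuclideanSpace ℝ (Fin 3)) r, M < ‖u t x‖) := by
  intro h
  obtain ⟨t, ht, x, -, hM⟩ := h 1 one_pos 0
  rw [hu t ht.2 x, norm_zero] at hM
  exact lt_irrefl 0 hM

/-! ### The self-similar leaf -/

/-- **Self-similar Type-I ancient mild fields vanish** (Tsai 1998 Thm 1, `q = ∞`, in the KNSS
gauge; the tree's `eq_zero_of_scaleInvariant` over the class `IsTypeIAncientMild`). -/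
theorem eq_zero_of_isSelfSimilar {C : ℝ}
    {w : ℝ → EuclideanSpace ℝ (Fin 3) → EuclideanSpace ℝ (Fin 3)}
    (hw : IsTypeIAncientMild C w) (hss : IsSelfSimilar w) : ∀ t < 0, ∀ x, w t x = 0 := by
  refine eq_zero_of_scaleInvariant hw.hasTypeITimeDecay hw.continuousOn_uncurry
    (fun s t hst ht x => hw.mild_eq_heatExtension hst ht x) (fun t ht => hw.isDivFree ht) ?_
  intro lam hlam s _ y
  have h := congrFun (congrFun (hss lam hlam) s) y
  rwa [nsRescale_apply] at h

/-- **The self-similar leaf of `stub_dssExclusion`** (regularity form): a self-similar member of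
the finite-dissipation stratum is bounded at the apex (indeed zero; the dissipation law is not
used). -/
theorem dssExclusion_of_isSelfSimilar (C K : ℝ)
    (w : ℝ → EuclideanSpace ℝ (Fin 3) → EuclideanSpace ℝ (Fin 3))
    (hw : IsTypeIAncientMild C w)
    (_hD : ∀ s : ℝ, s < 0 → ∫⁻ x, ‖fderiv ℝ (w s) x‖ₑ ^ 2 ≤ ENNReal.ofReal (K / Real.sqrt (-s)))
    (hss : IsSelfSimilar w) :
    ¬ (∀ r > 0, ∀ M : ℝ, ∃ t ∈ Set.Ioo (-(r ^ 2)) (0 : ℝ),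
        ∃ x ∈ Metric.ball (0 : EuclideanSpace ℝ (Fin 3)) r, M < ‖w t x‖) :=
  not_singularAtApex_of_eq_zero (eq_zero_of_isSelfSimilar hw hss)

/-! ### The near-identity leaf under the space-time Type-I envelope (Chae–Wolf 2017, Thm 1.3) -/

/-- **A `c`-DSS Type-I ancient mild field is a classical solution on the whole past** for some
smooth pressure (`c > 1`): the KNSS/Fabes–Jones–Rivière pressure on the window `(−2, 0)` and the
DSS continuation of Pineau–Vicol's bookkeeping lemma. -/
theorem exists_isClassicalNSSolutionOn_Iio_of_dss {C c : ℝ}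
    {w : ℝ → EuclideanSpace ℝ (Fin 3) → EuclideanSpace ℝ (Fin 3)}
    (hw : IsTypeIAncientMild C w) (hc : 1 < c) (hdss : IsDiscretelySelfSimilar c w) :
    ∃ P : ℝ → EuclideanSpace ℝ (Fin 3) → ℝ, IsClassicalNSSolutionOn (Iio 0) 1 0 w P := by
  obtain ⟨p, hp⟩ := hw.exists_isClassicalNSSolutionOn_Ioo (t₀ := -2) (by norm_num)
  have hp' : IsClassicalNSSolutionOn (Ico (-1 : ℝ) 0) 1 0 w p :=
    hp.mono (fun t ht => ⟨by linarith [ht.1], ht.2⟩) (uniqueDiffOn_Ico _ _)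
  have hrot : IsRotatedDSS c (LinearIsometryEquiv.refl ℝ (EuclideanSpace ℝ (Fin 3))) w :=
    isRotatedDSS_refl_iff.2 hdss
  exact exists_isClassicalNSSolutionOn_Iio_of_isRotatedDSS hp' hc hrot fun _ _ _ => rfl

/-- **The near-identity DSS leaf under the envelope (Liouville form).** For every `C₀ > 0` there is
`c₁ > 1` such that every Type-I ancient mild field in the KNSS gauge obeying the space-time Type-I
envelope `‖w(t,x)‖ ≤ C₀/(‖x‖ + √(−t))` and `c`-discretely self-similar for some `1 < c < c₁`
vanishes on `t < 0` (Chae–Wolf 2017 Thm 1.3, tree `chaeWolf2017_removing_dss_holds`, applied to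
the classical continuation `exists_isClassicalNSSolutionOn_Iio_of_dss`). -/
theorem exists_dss_threshold_of_envelope {C₀ : ℝ} (hC₀ : 0 < C₀) :
    ∃ c₁ : ℝ, 1 < c₁ ∧ ∀ (C c : ℝ)
      (w : ℝ → EuclideanSpace ℝ (Fin 3) → EuclideanSpace ℝ (Fin 3)), 1 < c → c < c₁ →
      IsTypeIAncientMild C w → HasTypeIDecay C₀ w → IsDiscretelySelfSimilar c w →
      ∀ t < 0, ∀ x, w t x = 0 := by
  obtain ⟨c₁, hc₁, H⟩ := chaeWolf2017_removing_dss_holds C₀ hC₀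
  refine ⟨c₁, hc₁, fun C c w hc hcc hw henv hdss => ?_⟩
  obtain ⟨P, hP⟩ := exists_isClassicalNSSolutionOn_Iio_of_dss hw hc hdss
  exact H c hc hcc w P hP hdss henv

/-- **The near-identity DSS leaf of `stub_dssExclusion` under the envelope** (regularity form):
for every `C₀ > 0` there is `c₁ > 1` such that every member of the finite-dissipation stratum with
the space-time envelope of constant `C₀` which is `c`-DSS for some `1 < c < c₁` is bounded at the
apex (indeed zero; the dissipation law is not used). -/
theorem dssExclusion_nearOne_of_envelope {C₀ : ℝ} (hC₀ : 0 < C₀) :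
    ∃ c₁ : ℝ, 1 < c₁ ∧ ∀ (C K c : ℝ)
      (w : ℝ → EuclideanSpace ℝ (Fin 3) → EuclideanSpace ℝ (Fin 3)), 1 < c → c < c₁ →
      IsTypeIAncientMild C w →
      (∀ s : ℝ, s < 0 → ∫⁻ x, ‖fderiv ℝ (w s) x‖ₑ ^ 2 ≤ ENNReal.ofReal (K / Real.sqrt (-s))) →
      HasTypeIDecay C₀ w → IsDiscretelySelfSimilar c w →
      ¬ (∀ r > 0, ∀ M : ℝ, ∃ t ∈ Set.Ioo (-(r ^ 2)) (0 : ℝ),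
          ∃ x ∈ Metric.ball (0 : EuclideanSpace ℝ (Fin 3)) r, M < ‖w t x‖) := by
  obtain ⟨c₁, hc₁, H⟩ := exists_dss_threshold_of_envelope hC₀
  exact ⟨c₁, hc₁, fun C K c w hc hcc hw _ henv hdss =>
    not_singularAtApex_of_eq_zero (H C c w hc hcc hw henv hdss)⟩

end Summit.NavierStokesRegularity.NavierStokesRegularity.Theorems.FiniteDissipationLiouville.Birth

end
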